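import Mathlib.Analysis.Distribution.FourierMultiplier
import Mathlib.Analysis.Distribution.Sobolev
import Mathlib.Analysis.Distribution.TemperateGrowth
import Mathlib.Analysis.Calculus.BumpFunction.Basic
import Mathlib.Analysis.Calculus.BumpFunction.InnerProduct
import Mathlib.MeasureTheory.Function.LpSeminorm.Basic
import Literature.Analysis.FunctionSpaces.BesselSobolevSpace
import Literature.Analysis.FunctionSpaces.BesovDifference
import Literature.Analysis.FunctionSpaces.HolderNorm
import HarnessLib

-- provenance: harness21/H21/H21/Prelude/Sobolev/LittlewoodPaley.lean @ 9c1e647 (interim HEAD d8f2665); M5 mechanical rewrite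
/-!
# Littlewood–Paley decomposition and Besov norms on `𝓢'(E, F)`

Trunk: Sobolev (outline `H21/Outlines/Sobolev.md`, item C14; notion
`littlewood_paley_besov_bmo`, part 1).

We set up the homogeneous dyadic Littlewood–Paley decomposition of tempered distributions on a
finite-dimensional real inner product space `E` (values in a complex Banach space `F`), and the
homogeneous / inhomogeneous Besov norms `‖u‖_{Ḃ^s_{p,q}}`, `‖u‖_{B^s_{p,q}}` built from it,
following Bahouri–Chemin–Danchin, *Fourier Analysis and Nonlinear PDE* (2011), Chapter 2.

## Mathlib anchors

* `ContDiffBump` (smooth bump `χ` with `χ = 1` on `B(0, rIn)`, `supp χ ⊆ B(0, rOut)`);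
* `TemperedDistribution.fourierMultiplierCLM F (g : E → ℂ) : 𝓢'(E, F) →L[ℂ] 𝓢'(E, F)`
  (`Mathlib/Analysis/Distribution/FourierMultiplier.lean`), the operator `g(D) = 𝓕⁻¹ g 𝓕`.
  **Warning** (outline finding 5): the underlying `SchwartzMap.smulLeftCLM` is *literally `0`*
  when the symbol `g` does not have temperate growth, so the temperate growth of our symbols
  (`hasTemperateGrowth_dyadicSymbol`, `hasTemperateGrowth_lowFreqSymbol`) is proved here for real,
  via `HasCompactSupport.hasTemperateGrowth`;
* `MeasureTheory.Lp.toTemperedDistribution` (the coercion `Lp F p volume → 𝓢'(E, F)`);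
* `MeasureTheory.eLpNorm · q Measure.count` is used as the `ℓ^q(ℤ)` norm of an `ℝ≥0∞`-valued
  sequence (Mathlib has `ENorm ℝ≥0∞` with `‖x‖ₑ = x`), so `q = ∞` is a genuine `⨆`
  (`MeasureTheory.eLpNormEssSup_count`).

Mathlib has no Littlewood–Paley blocks, no Besov spaces and no dilation operator on `𝓢'`
(searched: `Besov`, `LittlewoodPaley`, `dyadic`, `dilat` in `Mathlib/Analysis`); all of these
are defined below.

## Main definitions

* `Literature.dyadicCutoff E : ContDiffBump (0 : E)`: the *canonical* radial cutoff `χ` with `χ = 1` on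
  `‖ξ‖ ≤ 1` and `supp χ ⊆ {‖ξ‖ < 2}` (a definition, so all Besov norms below are canonical).
* `Literature.lowFreqSymbol j ξ = χ(2^{-j} ξ)`, `Literature.dyadicSymbol j ξ = χ(2^{-j} ξ) - χ(2^{1-j} ξ)`
  (complex-valued), supported in `‖ξ‖ < 2^{j+1}`, resp. `2^{j-1} < ‖ξ‖ < 2^{j+1}`.
* `Literature.lpBlock j = Δ̇_j = φ(2^{-j} D)`, `Literature.lowFreqCutoff j = Ṡ_j = χ(2^{-j} D)` on `𝓢'(E, F)`.
* `Literature.eLpNormDistrib p u ∈ [0, ∞]`: the `L^p` norm of a tempered distribution (`∞` if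
  `u ∉ L^p`).
* `Literature.eHomBesovNorm s p q u = ‖(2^{js} ‖Δ̇_j u‖_{L^p})_{j ∈ ℤ}‖_{ℓ^q}` and the class
  `Literature.Analysis.FunctionSpaces.MemHomBesov` (finite norm + the realisation condition `Ṡ_j u → 0` as `j → -∞`).
* `Literature.eBesovNorm s p q u = ‖Ṡ_0 u‖_{L^p} + ‖(2^{js} ‖Δ̇_j u‖_{L^p})_{j ≥ 1}‖_{ℓ^q}` and
  `Literature.Analysis.FunctionSpaces.MemBesov`.
* `Literature.distribDilate c : 𝓢'(E, F) →L[ℂ] 𝓢'(E, F)`: the dilation `u ↦ u(c ·)`, `c ∈ ℝˣ`.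

## Main statements (named facts, `Prop`-valued `def`s, not proved here; known results)

* `Literature.Analysis.FunctionSpaces.sum_dyadicSymbol`: `∑_j φ_j(ξ) = 1` for `ξ ≠ 0` (BCD Prop. 2.10).
* `Literature.Analysis.FunctionSpaces.lpBlock_lpBlock_eq_zero_of_lt`: `Δ̇_j Δ̇_{j'} = 0` if `|j - j'| ≥ 2` (BCD (2.4)).
* `Literature.Analysis.FunctionSpaces.memHomBesov_iff_memBesovSup`, `Literature.Analysis.FunctionSpaces.memBesov_top_iff_memBesovSup`: for `0 < s < 1` the
  Littlewood–Paley class `q = ∞` agrees with the finite-difference class `MemBesovSup` of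
  `H21/Prelude/Sobolev/BesovDifference.lean` (BCD Thm. 2.36; Triebel 1983, §2.5.12).
* `Literature.Analysis.FunctionSpaces.memBesov_top_top_iff_memBoundedHolder`, `Literature.Analysis.FunctionSpaces.memBesov_top_top_iff_memContDiffHolder`:
  `B^s_{∞,∞} = C^{k,r}_b` for non-integer `s = k + r` (Triebel 1983, Thm. 2.5.7).
* `Literature.Analysis.FunctionSpaces.eHomBesovNorm_distribDilate`: dyadic scaling `‖u(2^{j₀} ·)‖ = 2^{j₀(s - d/p)} ‖u‖`
  (BCD Prop. 2.18 / Rem. 2.19).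
* `Literature.Analysis.FunctionSpaces.besov_embedding`: `Ḃ^s_{p,q} ↪ Ḃ^{s - d(1/p - 1/r)}_{r,q}` for `p ≤ r` (BCD Prop. 2.20).

## Design notes

* Symbols are `E → ℂ` because `fourierMultiplierCLM F` takes complex symbols.
* The dyadic convention is the outline's: `χ = 1` on `B(0,1)`, `supp χ ⊆ B(0,2)`,
  `Ṡ_j = χ(2^{-j} D)` (as in BCD) and `φ_j = χ(2^{-j}·) - χ(2^{1-j}·)`, i.e. `Δ̇_j = Ṡ_j - Ṡ_{j-1}`
  (this is BCD's `Δ̇_{j-1}`, an immaterial index shift), so that `Ṡ_j = ∑_{j' ≤ j} Δ̇_{j'}`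
  formally and `Id = Ṡ_0 + ∑_{j ≥ 1} Δ̇_j`; the inhomogeneous norm therefore uses `Ṡ_0` and the
  blocks `j ≥ 1`.
* `eLpNormDistrib` is an infimum over `Lp` representatives (there is at most one, by
  `MeasureTheory.Lp.ker_toTemperedDistributionCLM_eq_bot`), hence `∞` off `L^p`; no junk `0`.
* The realisation condition in `MemHomBesov` is convergence `Ṡ_j u → 0` in `𝓢'(E, F)` (pointwise
  topology) as `j → -∞` (BCD Def. 1.26 uses the stronger `‖Ṡ_j u‖_{L^∞} → 0`; for
  distributions of finite homogeneous Besov norm with `s < d/p` the two agree, BCD Rem. 2.24).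

## References

* H. Bahouri, J.-Y. Chemin, R. Danchin, *Fourier Analysis and Nonlinear Partial Differential
  Equations*, Grundlehren 343, Springer (2011), Ch. 2 ("BCD").
* H. Triebel, *Theory of Function Spaces* (1983), §§2.3, 2.5.
-/

noncomputable section

open MeasureTheory TemperedDistribution Filter Topology Function
open scoped SchwartzMap ENNReal NNReal

namespace Literature.Analysis.FunctionSpaces

/-! ## The dyadic cutoff and the Littlewood–Paley symbols -/

section Symbols

open scoped ContDiff

variable {E : Type*} [NormedAddCommGroup E] [InnerProductSpace ℝ E]

variable (E) in
/-- The canonical smooth cutoff `χ : E → ℝ` of the Littlewood–Paley decomposition: Mathlib's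
bump function centred at `0` with `χ = 1` on the closed ball of radius `1` and support the open
ball of radius `2` (BCD Prop. 2.10, the function `χ` with `𝒞 = {3/4 ≤ |ξ| ≤ 8/3}` replaced by
Mathlib's canonical bump). This is a *definition*, so every norm below is canonical. [folklore] -/
def dyadicCutoff : ContDiffBump (0 : E) := ⟨1, 2, one_pos, one_lt_two⟩

/-- `χ(ξ) = 1` for `‖ξ‖ ≤ 1` (BCD Prop. 2.10). [folklore] -/
theorem dyadicCutoff_apply_of_norm_le_one {ξ : E} (h : ‖ξ‖ ≤ 1) : dyadicCutoff E ξ = 1 :=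
  (dyadicCutoff E).one_of_mem_closedBall (by simpa [dyadicCutoff] using h)

/-- `χ(ξ) = 0` for `2 ≤ ‖ξ‖` (BCD Prop. 2.10). [folklore] -/
theorem dyadicCutoff_apply_of_two_le_norm {ξ : E} (h : 2 ≤ ‖ξ‖) : dyadicCutoff E ξ = 0 :=
  (dyadicCutoff E).zero_of_le_dist (by simpa [dyadicCutoff] using h)

/-- The low-frequency symbol `χ(2^{-j} ξ)` of `Ṡ_j`, as a complex number (BCD (2.5),
`Ṡ_j = χ(2^{-j} D)`). [folklore] -/
def lowFreqSymbol (j : ℤ) (ξ : E) : ℂ := ((dyadicCutoff E (((2 : ℝ) ^ (-j)) • ξ) : ℝ) : ℂ)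

/-- The dyadic symbol `φ_j(ξ) = φ(2^{-j} ξ) = χ(2^{-j} ξ) - χ(2^{1-j} ξ)` of the homogeneous
Littlewood–Paley block `Δ̇_j`, as a complex number; it is supported in the annulus
`2^{j-1} < ‖ξ‖ < 2^{j+1}` (BCD Prop. 2.10 and (2.5)). [folklore] -/
def dyadicSymbol (j : ℤ) (ξ : E) : ℂ :=
  ((dyadicCutoff E (((2 : ℝ) ^ (-j)) • ξ) - dyadicCutoff E (((2 : ℝ) ^ (1 - j)) • ξ) : ℝ) : ℂ)

/-- `φ_j = χ(2^{-j}·) - χ(2^{-(j-1)}·)`, i.e. `Δ̇_j = Ṡ_{j} - Ṡ_{j-1}` at the level of symbols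
(BCD (2.5); BCD index the blocks so that `Δ̇_j = Ṡ_{j+1} - Ṡ_j`, i.e. our `Δ̇_j` is BCD's
`Δ̇_{j-1}` — an immaterial shift fixed by the outline; see the module docstring). [folklore] -/
theorem dyadicSymbol_eq_sub (j : ℤ) :
    (dyadicSymbol j : E → ℂ) = lowFreqSymbol j - lowFreqSymbol (j - 1) := by
  ext ξ
  simp [dyadicSymbol, lowFreqSymbol, neg_sub]

/-- The rescaled cutoffs `ξ ↦ χ(c ξ)` are smooth (chain rule; BCD Prop. 2.10). [folklore] -/
theorem contDiff_ofReal_dyadicCutoff_smul (c : ℝ) :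
    ContDiff ℝ ∞ (fun ξ : E => ((dyadicCutoff E (c • ξ) : ℝ) : ℂ)) :=
  Complex.ofRealCLM.contDiff.comp ((dyadicCutoff E).contDiff.comp (contDiff_const.smul contDiff_id))

/-- The low-frequency symbol `χ(2^{-j}·)` is smooth (BCD Prop. 2.10). [folklore] -/
theorem contDiff_lowFreqSymbol (j : ℤ) : ContDiff ℝ ∞ (lowFreqSymbol (E := E) j) :=
  contDiff_ofReal_dyadicCutoff_smul _

/-- The dyadic symbol `φ_j` is smooth (BCD Prop. 2.10). [folklore] -/
theorem contDiff_dyadicSymbol (j : ℤ) : ContDiff ℝ ∞ (dyadicSymbol (E := E) j) := by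
  rw [dyadicSymbol_eq_sub]
  exact (contDiff_lowFreqSymbol j).sub (contDiff_lowFreqSymbol (j - 1))

/-- `φ_j` vanishes on the low frequencies `‖ξ‖ ≤ 2^{j-1}` (BCD Prop. 2.10). [cite: BahouriCheminDanchin2011, Prop. 2.10] -/
def dyadicSymbol_apply_of_norm_le : Prop :=
  ∀ {j : ℤ} {ξ : E} (h : ‖ξ‖ ≤ (2 : ℝ) ^ (j - 1)),
    dyadicSymbol j ξ = 0

/-- `φ_j` vanishes on the high frequencies `2^{j+1} ≤ ‖ξ‖` (BCD Prop. 2.10). [cite: BahouriCheminDanchin2011, Prop. 2.10] -/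
def dyadicSymbol_apply_of_le_norm : Prop :=
  ∀ {j : ℤ} {ξ : E} (h : (2 : ℝ) ^ (j + 1) ≤ ‖ξ‖),
    dyadicSymbol j ξ = 0

/-- Local finiteness of the dyadic partition: for `ξ ≠ 0` only finitely many (in fact at most
two) `φ_j(ξ)` are nonzero (BCD Prop. 2.10). [cite: BahouriCheminDanchin2011, Prop. 2.10] -/
def finite_support_dyadicSymbol : Prop :=
  ∀ {ξ : E} (hξ : ξ ≠ 0),
    (Function.support fun j : ℤ => dyadicSymbol j ξ).Finite

/-- The homogeneous dyadic partition of unity: `∑_{j ∈ ℤ} φ_j(ξ) = 1` for every `ξ ≠ 0`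
(BCD Prop. 2.10, (2.3)); the sum is locally finite (`finite_support_dyadicSymbol`) and
telescopes to `lim_{N → ∞} χ(2^{-N} ξ) - lim_{N → -∞} χ(2^{-N} ξ) = 1 - 0`. [cite: BahouriCheminDanchin2011, Prop. 2.10] -/
def sum_dyadicSymbol : Prop :=
  ∀ {ξ : E} (hξ : ξ ≠ 0),
    HasSum (fun j : ℤ => dyadicSymbol j ξ) 1

variable [FiniteDimensional ℝ E]

/-- The rescaled cutoffs `ξ ↦ χ(c ξ)`, `c ≠ 0`, have compact support (BCD Prop. 2.10). [folklore] -/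
theorem hasCompactSupport_ofReal_dyadicCutoff_smul {c : ℝ} (hc : c ≠ 0) :
    HasCompactSupport (fun ξ : E => ((dyadicCutoff E (c • ξ) : ℝ) : ℂ)) :=
  ((dyadicCutoff E).hasCompactSupport.comp_homeomorph (Homeomorph.smulOfNeZero c hc)).comp_left
    Complex.ofReal_zero

/-- The low-frequency symbol `χ(2^{-j}·)` has compact support, contained in `‖ξ‖ < 2^{j+1}`
(BCD Prop. 2.10). [folklore] -/
theorem hasCompactSupport_lowFreqSymbol (j : ℤ) : HasCompactSupport (lowFreqSymbol (E := E) j) :=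
  hasCompactSupport_ofReal_dyadicCutoff_smul (zpow_ne_zero _ two_ne_zero)

/-- The low-frequency symbol `χ(2^{-j}·)` has temperate growth (real proof, mandatory: otherwise
`lowFreqCutoff j` would be the zero operator; BCD Prop. 2.10). [folklore] -/
theorem hasTemperateGrowth_lowFreqSymbol (j : ℤ) :
    (lowFreqSymbol (E := E) j).HasTemperateGrowth :=
  (hasCompactSupport_lowFreqSymbol j).hasTemperateGrowth (contDiff_lowFreqSymbol j)

/-- The dyadic symbol `φ_j` has compact support, contained in the annulus
`2^{j-1} ≤ ‖ξ‖ ≤ 2^{j+1}` (BCD Prop. 2.10). [folklore] -/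
theorem hasCompactSupport_dyadicSymbol (j : ℤ) : HasCompactSupport (dyadicSymbol (E := E) j) := by
  rw [dyadicSymbol_eq_sub]
  exact (hasCompactSupport_lowFreqSymbol j).sub (hasCompactSupport_lowFreqSymbol (j - 1))

/-- The dyadic symbol `φ_j` has temperate growth (real proof, mandatory: otherwise `lpBlock j`
would be the zero operator and every Besov norm below would vanish; BCD Prop. 2.10). [folklore] -/
theorem hasTemperateGrowth_dyadicSymbol (j : ℤ) :
    (dyadicSymbol (E := E) j).HasTemperateGrowth :=
  (hasCompactSupport_dyadicSymbol j).hasTemperateGrowth (contDiff_dyadicSymbol j)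

end Symbols

/-! ## Littlewood–Paley operators on `𝓢'(E, F)` -/

section Operators

variable {E F : Type*} [NormedAddCommGroup E] [InnerProductSpace ℝ E] [FiniteDimensional ℝ E]
  [MeasurableSpace E] [BorelSpace E] [NormedAddCommGroup F] [NormedSpace ℂ F]

/-- The homogeneous Littlewood–Paley block `Δ̇_j = φ_j(D) = 𝓕⁻¹ φ_j 𝓕` on tempered
distributions, the Fourier multiplier with symbol `dyadicSymbol j` (BCD (2.5)). [folklore] -/
def lpBlock (j : ℤ) : 𝓢'(E, F) →L[ℂ] 𝓢'(E, F) :=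
  fourierMultiplierCLM F (dyadicSymbol (E := E) j)

/-- The low-frequency cutoff `Ṡ_j = χ(2^{-j} D)` on tempered distributions, the Fourier
multiplier with symbol `lowFreqSymbol j` (BCD (2.5)). [folklore] -/
def lowFreqCutoff (j : ℤ) : 𝓢'(E, F) →L[ℂ] 𝓢'(E, F) :=
  fourierMultiplierCLM F (lowFreqSymbol (E := E) j)

/-- Unfolding `lpBlock` (BCD (2.5)). [folklore] -/
theorem lpBlock_apply (j : ℤ) (u : 𝓢'(E, F)) :
    lpBlock j u = fourierMultiplierCLM F (dyadicSymbol (E := E) j) u := rfl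

/-- Unfolding `lowFreqCutoff` (BCD (2.5)). [folklore] -/
theorem lowFreqCutoff_apply (j : ℤ) (u : 𝓢'(E, F)) :
    lowFreqCutoff j u = fourierMultiplierCLM F (lowFreqSymbol (E := E) j) u := rfl

/-- `Δ̇_j = Ṡ_j - Ṡ_{j-1}` (BCD (2.5), up to the index shift recorded in the module docstring). [cite: BahouriCheminDanchin2011, (2.5)] -/
def lpBlock_eq_sub : Prop :=
  ∀ (j : ℤ),
    (lpBlock j : 𝓢'(E, F) →L[ℂ] 𝓢'(E, F)) = lowFreqCutoff j - lowFreqCutoff (j - 1)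

/-- Blocks commute and multiply symbols: `Δ̇_j Δ̇_{j'} = (φ_j φ_{j'})(D)` (BCD §2.2; Mathlib's
`fourierMultiplierCLM_fourierMultiplierCLM_apply`, which needs the temperate growth of both
symbols — available here for real). [folklore] -/
theorem lpBlock_lpBlock (j j' : ℤ) (u : 𝓢'(E, F)) :
    lpBlock j (lpBlock j' u) = fourierMultiplierCLM F (dyadicSymbol j' * dyadicSymbol j) u :=
  fourierMultiplierCLM_fourierMultiplierCLM_apply (hasTemperateGrowth_dyadicSymbol j')
    (hasTemperateGrowth_dyadicSymbol j) u

/-- Quasi-orthogonality of the dyadic blocks: `Δ̇_j Δ̇_{j'} = 0` whenever `|j - j'| ≥ 2`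
(BCD (2.4)), since the annuli `2^{j-1} < ‖ξ‖ < 2^{j+1}` and `2^{j'-1} < ‖ξ‖ < 2^{j'+1}` are then
disjoint. [cite: BahouriCheminDanchin2011, (2.4)] -/
def lpBlock_lpBlock_eq_zero_of_lt : Prop :=
  ∀ {j j' : ℤ} (h : 1 < |j - j'|) (u : 𝓢'(E, F)),
    lpBlock j (lpBlock j' u) = 0

/-- The Littlewood–Paley decomposition of a Schwartz function converges in `𝓢'`:
`Ṡ_j φ → φ` as `j → +∞` (BCD Prop. 2.12). [cite: BahouriCheminDanchin2011, Prop. 2.12] -/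
def tendsto_lowFreqCutoff_atTop : Prop :=
  ∀ (φ : 𝓢(E, F)),
    Tendsto (fun j : ℤ => lowFreqCutoff j (φ : 𝓢'(E, F))) atTop (𝓝 (φ : 𝓢'(E, F)))

end Operators

/-! ## `L^p` norms of distributions and Besov norms -/

section Besov

variable {E F : Type*} [NormedAddCommGroup E] [InnerProductSpace ℝ E] [FiniteDimensional ℝ E]
  [MeasurableSpace E] [BorelSpace E] [NormedAddCommGroup F] [NormedSpace ℂ F] [CompleteSpace F]

/-- The `L^p` norm of a tempered distribution `u`: `‖f‖_{L^p}` if `u` is (the distribution of)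
some `f ∈ L^p(E; F)`, and `∞` otherwise. Implemented as an infimum over `Lp` representatives,
of which there is at most one (`MeasureTheory.Lp.ker_toTemperedDistributionCLM_eq_bot`)
(BCD §1.1, identification `L^p ⊂ 𝓢'`). [folklore] -/
def eLpNormDistrib (p : ℝ≥0∞) [Fact (1 ≤ p)] (u : 𝓢'(E, F)) : ℝ≥0∞ :=
  ⨅ (f : Lp F p (volume : Measure E)) (_ : (f : 𝓢'(E, F)) = u), ‖f‖ₑ

/-- The `L^p` norm of the distribution of `f ∈ L^p` is at most (in fact equal to, see
`eLpNormDistrib_coe`) `‖f‖_{L^p}` (BCD §1.1). [folklore] -/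
theorem eLpNormDistrib_coe_le {p : ℝ≥0∞} [Fact (1 ≤ p)] (f : Lp F p (volume : Measure E)) :
    eLpNormDistrib p (f : 𝓢'(E, F)) ≤ ‖f‖ₑ :=
  iInf_le_of_le f (iInf_le_of_le rfl le_rfl)

/-- The `L^p` norm of the distribution of `f ∈ L^p` is `‖f‖_{L^p}` (BCD §1.1; injectivity of
`L^p → 𝓢'`, `MeasureTheory.Lp.ker_toTemperedDistributionCLM_eq_bot`). [folklore] -/
theorem eLpNormDistrib_coe {p : ℝ≥0∞} [Fact (1 ≤ p)] (f : Lp F p (volume : Measure E)) :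
    eLpNormDistrib p (f : 𝓢'(E, F)) = ‖f‖ₑ := by
  refine le_antisymm (eLpNormDistrib_coe_le f) (le_iInf₂ fun g hg => ?_)
  have hker := Lp.ker_toTemperedDistributionCLM_eq_bot (F := F) (μ := (volume : Measure E))
    (p := p)
  rw [LinearMap.ker_eq_bot] at hker
  rw [(hker hg : g = f)]

/-- A distribution not represented by an `L^p` function has infinite `L^p` norm (by definition;
BCD §1.1). [folklore] -/
theorem eLpNormDistrib_of_forall_ne {p : ℝ≥0∞} [Fact (1 ≤ p)] {u : 𝓢'(E, F)}
    (h : ∀ f : Lp F p (volume : Measure E), (f : 𝓢'(E, F)) ≠ u) : eLpNormDistrib p u = ∞ := by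
  simp [eLpNormDistrib, h]

/-- The `L^p` norm of the zero distribution vanishes (BCD §1.1). [folklore] -/
@[simp]
theorem eLpNormDistrib_zero {p : ℝ≥0∞} [Fact (1 ≤ p)] : eLpNormDistrib p (0 : 𝓢'(E, F)) = 0 :=
  le_antisymm (iInf_le_of_le (0 : Lp F p (volume : Measure E)) (iInf_le_of_le
    (by rw [← Lp.toTemperedDistributionCLM_apply, map_zero]) (by simp))) bot_le

/-- The weighted dyadic pieces `2^{js} ‖Δ̇_j u‖_{L^p} ∈ [0, ∞]` of the homogeneous Besov norm
(BCD Def. 2.15). [folklore] -/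
def lpBlockWeight (s : ℝ) (p : ℝ≥0∞) [Fact (1 ≤ p)] (u : 𝓢'(E, F)) (j : ℤ) : ℝ≥0∞ :=
  (2 : ℝ≥0∞) ^ ((j : ℝ) * s) * eLpNormDistrib p (lpBlock j u)

/-- The homogeneous Besov norm
`‖u‖_{Ḃ^s_{p,q}} = ‖(2^{js} ‖Δ̇_j u‖_{L^p})_{j ∈ ℤ}‖_{ℓ^q(ℤ)} ∈ [0, ∞]` (BCD Def. 2.15). The
`ℓ^q(ℤ)` norm is Mathlib's `eLpNorm` for the counting measure on `ℤ`, so `q = ∞` is the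
supremum `⨆ j, 2^{js} ‖Δ̇_j u‖_{L^p}` (`eHomBesovNorm_top`); meaningful for `1 ≤ q` (for
`q = 0` Mathlib's `eLpNorm` is `0`). [folklore] -/
def eHomBesovNorm (s : ℝ) (p q : ℝ≥0∞) [Fact (1 ≤ p)] (u : 𝓢'(E, F)) : ℝ≥0∞ :=
  eLpNorm (lpBlockWeight s p u) q Measure.count

/-- For `q = ∞` the homogeneous Besov norm is `sup_j 2^{js} ‖Δ̇_j u‖_{L^p}` (BCD Def. 2.15). [folklore] -/
theorem eHomBesovNorm_top (s : ℝ) (p : ℝ≥0∞) [Fact (1 ≤ p)] (u : 𝓢'(E, F)) :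
    eHomBesovNorm s p ∞ u = ⨆ j : ℤ, (2 : ℝ≥0∞) ^ ((j : ℝ) * s) * eLpNormDistrib p (lpBlock j u) := by
  simp [eHomBesovNorm, lpBlockWeight]

/-- For `0 < q < ∞` the homogeneous Besov norm is `(∑_j (2^{js} ‖Δ̇_j u‖_{L^p})^q)^{1/q}`
(BCD Def. 2.15). [cite: BahouriCheminDanchin2011, Def. 2.15] -/
def eHomBesovNorm_eq_tsum_rpow : Prop :=
  ∀ {s : ℝ} {p q : ℝ≥0∞} [Fact (1 ≤ p)] (hq₀ : q ≠ 0) (hq : q ≠ ∞) (u : 𝓢'(E, F)),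
    eHomBesovNorm s p q u = (∑' j : ℤ, lpBlockWeight s p u j ^ q.toReal) ^ (1 / q.toReal)

/-- The homogeneous Besov norm of `0` vanishes (BCD Def. 2.15). [folklore] -/
@[simp]
theorem eHomBesovNorm_zero (s : ℝ) (p q : ℝ≥0∞) [Fact (1 ≤ p)] :
    eHomBesovNorm s p q (0 : 𝓢'(E, F)) = 0 := by
  have : lpBlockWeight s p (0 : 𝓢'(E, F)) = 0 := by
    ext j
    simp [lpBlockWeight]
  simp [eHomBesovNorm, this]

/-- Membership in the homogeneous Besov space `Ḃ^s_{p,q}(E; F)` (BCD Def. 2.15 with Def. 1.26):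
finite homogeneous Besov norm **and** the realisation condition `Ṡ_j u → 0` in `𝓢'` as
`j → -∞` (which excludes polynomials, all of whose blocks `Δ̇_j u` vanish). [folklore] -/
def MemHomBesov (s : ℝ) (p q : ℝ≥0∞) [Fact (1 ≤ p)] (u : 𝓢'(E, F)) : Prop :=
  eHomBesovNorm s p q u < ∞ ∧ Tendsto (fun j : ℤ => lowFreqCutoff j u) atBot (𝓝 0)

/-- A distribution in `Ḃ^s_{p,q}` has finite homogeneous Besov norm (BCD Def. 2.15). [folklore] -/
theorem MemHomBesov.eHomBesovNorm_lt_top {s : ℝ} {p q : ℝ≥0∞} [Fact (1 ≤ p)] {u : 𝓢'(E, F)}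
    (h : MemHomBesov s p q u) : eHomBesovNorm s p q u < ∞ :=
  h.1

/-- A distribution in `Ḃ^s_{p,q}` satisfies `Ṡ_j u → 0` as `j → -∞` (BCD Def. 1.26). [folklore] -/
theorem MemHomBesov.tendsto_lowFreqCutoff {s : ℝ} {p q : ℝ≥0∞} [Fact (1 ≤ p)] {u : 𝓢'(E, F)}
    (h : MemHomBesov s p q u) : Tendsto (fun j : ℤ => lowFreqCutoff j u) atBot (𝓝 0) :=
  h.2

/-- `0 ∈ Ḃ^s_{p,q}` (BCD Def. 2.15). [folklore] -/
theorem memHomBesov_zero (s : ℝ) (p q : ℝ≥0∞) [Fact (1 ≤ p)] :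
    MemHomBesov s p q (0 : 𝓢'(E, F)) :=
  ⟨by simp, by simpa only [map_zero] using tendsto_const_nhds⟩

/-- The weighted inhomogeneous dyadic pieces `2^{js} ‖Δ̇_j u‖_{L^p}`, `j = n + 1 ≥ 1`
(BCD Def. 2.68). [folklore] -/
def lpBlockWeightSucc (s : ℝ) (p : ℝ≥0∞) [Fact (1 ≤ p)] (u : 𝓢'(E, F)) (n : ℕ) : ℝ≥0∞ :=
  lpBlockWeight s p u ((n : ℤ) + 1)

/-- The inhomogeneous Besov norm
`‖u‖_{B^s_{p,q}} = ‖Ṡ_0 u‖_{L^p} + ‖(2^{js} ‖Δ̇_j u‖_{L^p})_{j ≥ 1}‖_{ℓ^q}` (BCD Def. 2.68, with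
the low-frequency block `Δ_{-1} = Ṡ_0 = χ(D)` separated; equivalent to BCD's single `ℓ^q` norm).
Meaningful for `1 ≤ q`. [folklore] -/
def eBesovNorm (s : ℝ) (p q : ℝ≥0∞) [Fact (1 ≤ p)] (u : 𝓢'(E, F)) : ℝ≥0∞ :=
  eLpNormDistrib p (lowFreqCutoff 0 u) + eLpNorm (lpBlockWeightSucc s p u) q Measure.count

/-- Membership in the inhomogeneous Besov space `B^s_{p,q}(E; F)`: finite inhomogeneous Besov
norm (BCD Def. 2.68). No realisation condition is needed (`Ṡ_0 u ∈ L^p` already). [folklore] -/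
def MemBesov (s : ℝ) (p q : ℝ≥0∞) [Fact (1 ≤ p)] (u : 𝓢'(E, F)) : Prop :=
  eBesovNorm s p q u < ∞

/-- The inhomogeneous Besov norm of `0` vanishes (BCD Def. 2.68). [folklore] -/
@[simp]
theorem eBesovNorm_zero (s : ℝ) (p q : ℝ≥0∞) [Fact (1 ≤ p)] :
    eBesovNorm s p q (0 : 𝓢'(E, F)) = 0 := by
  have : lpBlockWeightSucc s p (0 : 𝓢'(E, F)) = 0 := by
    ext j
    simp [lpBlockWeightSucc, lpBlockWeight]
  simp [eBesovNorm, this]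

/-- `0 ∈ B^s_{p,q}` (BCD Def. 2.68). [folklore] -/
theorem memBesov_zero (s : ℝ) (p q : ℝ≥0∞) [Fact (1 ≤ p)] : MemBesov s p q (0 : 𝓢'(E, F)) := by
  simp [MemBesov]

/-- `B^s_{p,q} = L^p ∩ Ḃ^s_{p,q}` for `s > 0` and `p < ∞` (BCD Thm. 2.69 / Rem. 2.70): an `L^p`
function has finite inhomogeneous Besov norm iff it has finite homogeneous Besov norm. [cite: BahouriCheminDanchin2011, Thm. 2.69] -/
def memBesov_coe_iff_memHomBesov : Prop :=
  ∀ {s : ℝ} (hs : 0 < s) {p q : ℝ≥0∞} [Fact (1 ≤ p)] (hp : p ≠ ∞) (f : Lp F p (volume : Measure E)),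
    MemBesov s p q (f : 𝓢'(E, F)) ↔ MemHomBesov s p q (f : 𝓢'(E, F))

end Besov

/-! ## Comparison with finite differences and Hölder classes -/

section Characterisations

variable {E F : Type*} [NormedAddCommGroup E] [InnerProductSpace ℝ E] [FiniteDimensional ℝ E]
  [MeasurableSpace E] [BorelSpace E] [NormedAddCommGroup F] [NormedSpace ℂ F] [CompleteSpace F]

/-- Finite-difference characterisation of `Ḃ^s_{p,∞}`, `0 < s < 1`, `1 ≤ p < ∞` (BCD Thm. 2.36):
an `L^p` function `f` lies in the Littlewood–Paley class `Ḃ^s_{p,∞}` iff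
`sup_{h ≠ 0} ‖f(· + h) - f‖_{L^p} / ‖h‖^s < ∞`, i.e. iff `MemBesovSup s p f volume`
(`H21/Prelude/Sobolev/BesovDifference.lean`). (`p = ∞` is excluded only because of the
realisation condition: constants have vanishing difference quotients but `Ṡ_j c = c ↛ 0`.) [cite: BahouriCheminDanchin2011, Thm. 2.36] -/
def memHomBesov_iff_memBesovSup : Prop :=
  ∀ {s : ℝ} (hs₀ : 0 < s) (hs₁ : s < 1) {p : ℝ≥0∞} [Fact (1 ≤ p)] (hp : p ≠ ∞) (f : Lp F p (volume : Measure E)),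
    MemHomBesov s p ∞ (f : 𝓢'(E, F)) ↔ MemBesovSup s p (f : E → F) volume

/-- Finite-difference characterisation of the inhomogeneous `B^s_{p,∞}`, `0 < s < 1`, `1 ≤ p ≤ ∞`
(Triebel 1983, Thm. 2.5.12; BCD Thm. 2.36): for `f ∈ L^p`,
`f ∈ B^s_{p,∞} ↔ sup_{h ≠ 0} ‖f(· + h) - f‖_{L^p} / ‖h‖^s < ∞`. [cite: Triebel1983, Thm. 2.5.12] -/
def memBesov_top_iff_memBesovSup : Prop :=
  ∀ {s : ℝ} (hs₀ : 0 < s) (hs₁ : s < 1) {p : ℝ≥0∞} [Fact (1 ≤ p)] (f : Lp F p (volume : Measure E)),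
    MemBesov s p ∞ (f : 𝓢'(E, F)) ↔ MemBesovSup s p (f : E → F) volume

/-- `B^s_{∞,∞} = C^{0,s}_b` for `0 < s < 1` (Triebel 1983, Thm. 2.5.7 and §2.5.12; BCD §2.7,
Examples): a tempered distribution lies in `B^s_{∞,∞}` iff it is (the distribution of) a
bounded `s`-Hölder function, `MemBoundedHolder` of `H21/Prelude/Sobolev/HolderNorm.lean`. The
function is packaged through `MemLp f ∞` and the coercion `L^∞ → 𝓢'`. [cite: Triebel1983, Thm. 2.5.7 and §2.5.12] -/
def memBesov_top_top_iff_memBoundedHolder : Prop :=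
  ∀ {s : ℝ} (hs₀ : 0 < s) (hs₁ : s < 1) (u : 𝓢'(E, F)),
    MemBesov s ∞ ∞ u ↔ ∃ (f : E → F) (hf : MemLp f ∞ (volume : Measure E)),
      MemBoundedHolder ⟨s, hs₀.le⟩ f ∧ ((hf.toLp f : Lp F ∞ (volume : Measure E)) : 𝓢'(E, F)) = u

/-- `B^{k+r}_{∞,∞} = C^{k,r}_b` for `k ∈ ℕ`, `0 < r < 1` (non-integer regularity; Triebel 1983,
Thm. 2.5.7): a tempered distribution lies in `B^{k+r}_{∞,∞}` iff it is (the distribution of) a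
`C^k` function with bounded derivatives up to order `k` and `r`-Hölder `k`-th derivative,
`MemContDiffHolder k r` of `H21/Prelude/Sobolev/HolderNorm.lean` (real differentiability via
Mathlib's `NormedSpace.complexToReal`). [cite: Triebel1983, Thm. 2.5.7] -/
def memBesov_top_top_iff_memContDiffHolder : Prop :=
  ∀ (k : ℕ) {r : ℝ≥0} (hr₀ : 0 < r) (hr₁ : r < 1) (u : 𝓢'(E, F)),
    MemBesov ((k : ℝ) + r) ∞ ∞ u ↔ ∃ (f : E → F) (hf : MemLp f ∞ (volume : Measure E)),
      MemContDiffHolder k r f ∧ ((hf.toLp f : Lp F ∞ (volume : Measure E)) : 𝓢'(E, F)) = u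

end Characterisations

/-! ## Scaling and embeddings -/

section Dilation

variable {E F : Type*} [NormedAddCommGroup E] [NormedSpace ℝ E] [NormedAddCommGroup F]
  [NormedSpace ℂ F]

/-- The dilation `u ↦ u(c ·)` of a tempered distribution by `c ∈ ℝˣ`, defined by duality:
`⟨u(c ·), φ⟩ = |c|^{-d} ⟨u, φ(c⁻¹ ·)⟩`, `d = dim E` (BCD §1.2.1, dilations of `𝓢'`; built from
Mathlib's `SchwartzMap.compCLMOfContinuousLinearEquiv` and `PointwiseConvergenceCLM.precomp`). [folklore] -/
def distribDilate (c : ℝˣ) : 𝓢'(E, F) →L[ℂ] 𝓢'(E, F) :=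
  ((|(c : ℝ)|⁻¹ ^ Module.finrank ℝ E : ℝ) : ℂ) •
    PointwiseConvergenceCLM.precomp F
      (SchwartzMap.compCLMOfContinuousLinearEquiv ℂ
        (ContinuousLinearEquiv.smulLeft (c⁻¹ : ℝˣ) : E ≃L[ℝ] E))

/-- Unfolding the dilation: `⟨u(c ·), φ⟩ = |c|^{-d} ⟨u, φ(c⁻¹ ·)⟩` (BCD §1.2.1). [folklore] -/
theorem distribDilate_apply_apply (c : ℝˣ) (u : 𝓢'(E, F)) (φ : 𝓢(E, ℂ)) :
    distribDilate c u φ = ((|(c : ℝ)|⁻¹ ^ Module.finrank ℝ E : ℝ) : ℂ) •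
      u (SchwartzMap.compCLMOfContinuousLinearEquiv ℂ
        (ContinuousLinearEquiv.smulLeft (c⁻¹ : ℝˣ) : E ≃L[ℝ] E) φ) :=
  rfl

end Dilation

section Scaling

variable {E F : Type*} [NormedAddCommGroup E] [InnerProductSpace ℝ E] [FiniteDimensional ℝ E]
  [MeasurableSpace E] [BorelSpace E] [NormedAddCommGroup F] [NormedSpace ℂ F] [CompleteSpace F]

/-- The dilation of distributions extends the dilation of functions: for `f ∈ L^p` and the
dilated function `g = f(c ·) ∈ L^p`, `distribDilate c f = g` (change of variables; BCD §1.2.1). [cite: BahouriCheminDanchin2011, §1.2.1] -/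
def distribDilate_coe : Prop :=
  ∀ {p : ℝ≥0∞} [Fact (1 ≤ p)] (c : ℝˣ) (f g : Lp F p (volume : Measure E)) (hfg : (g : E → F) =ᵐ[volume] fun x => (f : E → F) ((c : ℝ) • x)),
    distribDilate c (f : 𝓢'(E, F)) = (g : 𝓢'(E, F))

/-- Dilations commute with the dyadic blocks up to an index shift:
`Δ̇_j (u(2^{j₀} ·)) = (Δ̇_{j - j₀} u)(2^{j₀} ·)` (BCD Prop. 2.18, proof). [cite: BahouriCheminDanchin2011, Prop. 2.18] -/
def lpBlock_distribDilate : Prop :=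
  ∀ (j j₀ : ℤ) (u : 𝓢'(E, F)),
    lpBlock j (distribDilate (Units.mk0 ((2 : ℝ) ^ j₀) (zpow_ne_zero j₀ two_ne_zero)) u) =
      distribDilate (Units.mk0 ((2 : ℝ) ^ j₀) (zpow_ne_zero j₀ two_ne_zero)) (lpBlock (j - j₀) u)

/-- Dyadic scaling of the homogeneous Besov norm (BCD Prop. 2.18 / Rem. 2.19):
`‖u(2^{j₀} ·)‖_{Ḃ^s_{p,q}} = 2^{j₀ (s - d/p)} ‖u‖_{Ḃ^s_{p,q}}`, `d = dim E` (exact equality for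
dyadic dilations; for general `λ > 0` only up to constants). For `p = ∞`, `d/p = 0`
(`(∞ : ℝ≥0∞).toReal = 0`). [cite: BahouriCheminDanchin2011, Prop. 2.18] -/
def eHomBesovNorm_distribDilate : Prop :=
  ∀ (s : ℝ) (p q : ℝ≥0∞) [Fact (1 ≤ p)] (j₀ : ℤ) (u : 𝓢'(E, F)),
    eHomBesovNorm s p q (distribDilate (Units.mk0 ((2 : ℝ) ^ j₀) (zpow_ne_zero j₀ two_ne_zero)) u) =
      (2 : ℝ≥0∞) ^ ((j₀ : ℝ) * (s - Module.finrank ℝ E / p.toReal)) * eHomBesovNorm s p q u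

/-- `MemHomBesov` is dilation invariant (BCD Prop. 2.18). [cite: BahouriCheminDanchin2011, Prop. 2.18] -/
def MemHomBesov.distribDilate : Prop :=
  ∀ {s : ℝ} {p q : ℝ≥0∞} [Fact (1 ≤ p)] {u : 𝓢'(E, F)} (h : MemHomBesov s p q u) (j₀ : ℤ),
    MemHomBesov s p q (Literature.Analysis.FunctionSpaces.distribDilate (Units.mk0 ((2 : ℝ) ^ j₀) (zpow_ne_zero j₀ two_ne_zero)) u)

/-- The Besov embedding (BCD Prop. 2.20): for `1 ≤ p ≤ r ≤ ∞` there is a constant `C` with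
`‖u‖_{Ḃ^{s - d(1/p - 1/r)}_{r,q}} ≤ C ‖u‖_{Ḃ^s_{p,q}}` for all `u ∈ 𝓢'` (Bernstein's inequality
on each block). Here `1/∞ = 0` via `(∞ : ℝ≥0∞).toReal⁻¹ = 0`. [cite: BahouriCheminDanchin2011, Prop. 2.20] -/
def besov_embedding : Prop :=
  ∀ (s : ℝ) {p r : ℝ≥0∞} [Fact (1 ≤ p)] [Fact (1 ≤ r)] (hpr : p ≤ r) (q : ℝ≥0∞),
    ∃ C : ℝ≥0, ∀ u : 𝓢'(E, F),
      eHomBesovNorm (s - Module.finrank ℝ E * (p.toReal⁻¹ - r.toReal⁻¹)) r q u ≤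
        C * eHomBesovNorm s p q u

/-- The Besov embedding at the level of classes (BCD Prop. 2.20):
`Ḃ^s_{p,q} ⊂ Ḃ^{s - d(1/p - 1/r)}_{r,q}` for `p ≤ r`. [cite: BahouriCheminDanchin2011, Prop. 2.20] -/
def MemHomBesov.of_exponent_le : Prop :=
  ∀ {s : ℝ} {p r q : ℝ≥0∞} [Fact (1 ≤ p)] [Fact (1 ≤ r)] (hpr : p ≤ r) {u : 𝓢'(E, F)} (h : MemHomBesov s p q u),
    MemHomBesov (s - Module.finrank ℝ E * (p.toReal⁻¹ - r.toReal⁻¹)) r q u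

end Scaling

end Literature.Analysis.FunctionSpaces

/-! ## Discharges -/

namespace Literature.Analysis.FunctionSpaces

section Discharges

variable {E F : Type*} [NormedAddCommGroup E] [InnerProductSpace ℝ E] [FiniteDimensional ℝ E]
  [MeasurableSpace E] [BorelSpace E] [NormedAddCommGroup F] [NormedSpace ℂ F] [CompleteSpace F]

/-- Discharge of `eHomBesovNorm_eq_tsum_rpow`: for `0 < q < ∞`,
`‖u‖_{Ḃ^s_{p,q}} = (∑_{j ∈ ℤ} (2^{js} ‖Δ̇_j u‖_{L^p})^q)^{1/q}`. BCD Def. 2.15 *defines*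
`‖u‖_{Ḃ^s_{p,r}} := (∑_{j ∈ ℤ} 2^{rjs} ‖Δ̇_j u‖^r_{L^p})^{1/r}` (with the usual supremum for
`r = ∞`); here `eHomBesovNorm` is Mathlib's `eLpNorm` of the weight sequence for the counting measure
on `ℤ`, and the identity is `eLpNorm f q count = (∫⁻ ‖f‖ₑ^q ∂count)^{1/q}`
(`MeasureTheory.eLpNorm_eq_lintegral_rpow_enorm_toReal`) together with `∫⁻ ∂count = ∑'`
(`MeasureTheory.lintegral_count`) and `‖x‖ₑ = x` on `ℝ≥0∞`. [cite: BahouriCheminDanchin2011, Def. 2.15] -/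
theorem eHomBesovNorm_eq_tsum_rpow_holds : eHomBesovNorm_eq_tsum_rpow (E := E) (F := F) := by
  intro s p q _ hq₀ hq u
  rw [eHomBesovNorm, eLpNorm_eq_lintegral_rpow_enorm_toReal hq₀ hq, lintegral_count]
  simp only [enorm_eq_self]

end Discharges

end Literature.Analysis.FunctionSpaces
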